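import Summits.ResolutionOfSingularities.ResolutionOfSingularities.Theorems.RadicialJungCleanModelsReadOffCriticalMaximiser
import Literature.AlgebraicGeometry.Resolution.StrictNormalCrossingsDescent
import HarnessLib

/-!
# [OURS · L W8.1 · T2 brick B7, PART (5)] At a critical point the exponents of the principal
# monomial `J(O, f; log x, y) = (xᵃyᵇ)` are at least two (Giraud 1983, Prop. 1.5, p. 113:
# «si K(i) = ∅, A(i) = p·r(i) ≥ 2; sinon A(i) = ord(x_i ∂f/∂x_i) ≥ 2»), and the read-off without the
# hypotheses `2 ≤ a`, `2 ≤ b`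

Programme `PROGRAMME-clean-dim2` / T2 (res-L0-w81-pv-2 g5), spec `HOME/L/res-L0-w81-pv-2/g5/B7-SPEC.md`
§(5); crux stmt-ResolutionOfSingularities-15917 (`T2Skeleton.lean` v2, stub `stub_readOff_critical`);
`--supports … --as helper`. OURS; AI-written, weaker than expert review; nothing here is a statement of
H. Hironaka's manuscript.

Setting of `…ReadOffCriticalMaximiser` § 4: `O` a two-dimensional regular local `𝔽_p`-algebra,
formally smooth over `𝔽_p`, regular parameters `x, y` in a `p`-basis `Γ` of `O` over `O^p`, and
`J(O, f; log x, y) := ({D f : x ∣ D x, y ∣ D y}) = (xᵃyᵇ)` (resp. `J(O, f; log x) = (xᵃ)`).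
CRITICALITY of the branch `x = 0` means `J(O, f) ⊆ (x)` (`derivJacobianIdeal O f ≤ (x)`: the prime
`(x)` is one of `derivCriticalPrimes O f`, i.e. a branch of `E(f)` through the point).

* § 1 `two_le_of_span_logDerivation_eq` — crossing point, both branches critical ⇒ `2 ≤ a ∧ 2 ≤ b`;
  `two_le_of_span_logDerivation_eq₁` — one branch ⇒ `2 ≤ a`. Argument (OURS, after Giraud p. 113):
  `a ≥ 1` since `xᵃyᵇ ∈ J ⊆ J(O,f) ⊆ (x)` and `(x)` is prime with `y ∉ (x)`; if `a = 1`, write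
  `f = gᵖ + u·x·yᵇ` with the MAXIMISER `g` of `…Maximiser` § 3, differentiate with `∂ₓ` (dual to
  `x`): `∂ₓ f = x yᵇ ∂ₓu + u yᵇ ∈ (x)` forces `u ∈ (x)`, so `f = gᵖ + u′·x²yᵇ`, whence every
  logarithmic `D f ∈ (x²yᵇ)` (`derivation_apply_realiser`) and `x yᵇ ∈ J ⊆ (x²yᵇ)` makes `x` a
  unit — absurd.
* § 2 **`giraud15NormalFormAt_crossing_of_critical`** / **`…_noncrossing_of_critical`** — the § 4
  compositions of `…Maximiser` with `2 ≤ a`, `2 ≤ b` REPLACED by criticality. With these, the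
  closer of `stub_readOff_critical` needs exactly: the adapted `p`-basis `Γ ∋ x, y` (res-L0-w81-pv-2's
  `exists_isPBasisOver_containing_rsop`, in hand), and «(*) ∧ c = 0 ⇒ derivCriticalPrimes = {(x), (y)}
  (resp. {(x)}) ∧ J(O, f, E(f)) = (xᵃyᵇ)» (spec parts (1)(2)) plus scheme-to-stalk plumbing.

References: J. Giraud, Bull. SMF 111 (1983), Prop. 1.5 and its proof p. 113 [Giraud1983].
-/

noncomputable section

set_option linter.dupNamespace false -- mandated namespace of this single-conjunct summit

open IsLocalRing
open Literature.RingTheory.PBasis Literature.AlgebraicGeometry.Resolution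

namespace Summit.ResolutionOfSingularities.ResolutionOfSingularities.Theorems.RadicialJung.CleanModels

universe u

/-! ## § 0 Bookkeeping on the regular system of parameters `(x, y)` -/

/-- For regular parameters `x, y` of a two-dimensional regular local ring: `(x)` is prime and
`y ∉ (x)`. [cite: Matsumura1987, Thm. 14.3] -/
theorem isPrime_span_singleton_and_not_mem_of_rsop₂ {O : Type u} [CommRing O]
    [IsRegularLocalRing O] (hdim : ringKrullDim O = 2) {x y : O}
    (hxy : Ideal.span {x, y} = maximalIdeal O) :
    (Ideal.span {x}).IsPrime ∧ y ∉ Ideal.span {x} := by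
  classical
  have hdim' : ringKrullDim O = ((2 + 0 : ℕ) : WithBot ℕ∞) := hdim
  have hspan : Ideal.span (Set.range ![x, y] ∪ Set.range (![] : Fin 0 → O)) = maximalIdeal O := by
    rw [← hxy, Matrix.range_cons, Matrix.range_cons, Matrix.range_empty]
    simp only [Set.union_empty, Set.singleton_union]
  refine ⟨by simpa using isPrime_span_singleton_of_rsop ![x, y] ![] hdim' hspan 0, fun h => ?_⟩
  have h1 : (![x, y] : Fin 2 → O) 1 ∈ Ideal.span {(![x, y] : Fin 2 → O) 0} := by simpa using h
  have := eq_of_rsop_mem_span_singleton ![x, y] ![] hdim' hspan h1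
  exact absurd this (by decide)

/-- `J(O, f; log x, y) ⊆ J(O, f)`: the logarithmic values `D f` are values of derivations. [folklore] -/
theorem span_logDerivation_le_derivJacobianIdeal {O : Type u} [CommRing O] (x y f : O) :
    Ideal.span {v : O | ∃ D : Derivation ℤ O O, x ∣ D x ∧ y ∣ D y ∧ D f = v} ≤
      derivJacobianIdeal O f := by
  refine Ideal.span_le.mpr ?_
  rintro v ⟨D, -, -, rfl⟩
  exact Ideal.subset_span ⟨D, rfl⟩

/-- `J(O, f; log x) ⊆ J(O, f)`. [folklore] -/
theorem span_logDerivation_le_derivJacobianIdeal₁ {O : Type u} [CommRing O] (x f : O) :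
    Ideal.span {v : O | ∃ D : Derivation ℤ O O, x ∣ D x ∧ D f = v} ≤ derivJacobianIdeal O f := by
  refine Ideal.span_le.mpr ?_
  rintro v ⟨D, -, rfl⟩
  exact Ideal.subset_span ⟨D, rfl⟩

/-- In a local ring, `r·(x²·m) = x·m` with `x ∈ 𝔪` forces `x·m = 0`. [folklore] -/
theorem mul_eq_zero_of_mul_sq_mul_eq {O : Type u} [CommRing O] [IsLocalRing O] {x m r : O}
    (hx : x ∈ maximalIdeal O) (h : r * (x ^ 2 * m) = x ^ 1 * m) : x * m = 0 := by
  have e : (1 - r * x) * (x * m) = x ^ 1 * m - r * (x ^ 2 * m) := by ring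
  rw [h, sub_self] at e
  have hu : IsUnit (1 - r * x) := by
    by_contra hnu
    have h1 : (1 : O) - r * x ∈ maximalIdeal O := (mem_maximalIdeal _).mpr hnu
    have : (1 : O) ∈ maximalIdeal O := by
      have := Ideal.add_mem _ h1 (Ideal.mul_mem_left _ r hx)
      rwa [sub_add_cancel] at this
    exact (maximalIdeal.isMaximal O).ne_top ((Ideal.eq_top_iff_one _).mpr this)
  exact (hu.mul_right_eq_zero).mp e

/-! ## § 1 The exponents are at least two -/

/-- **Crossing point, both branches critical ⇒ `a ≥ 2` (the `x`-exponent).** [cite: Giraud1983,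
Prop. 1.5, proof p. 113] -/
theorem two_le_fst_of_span_logDerivation_eq (p : ℕ) [Fact p.Prime] {O : Type u} [CommRing O]
    [IsRegularLocalRing O] [Algebra (ZMod p) O] [Algebra.FormallySmooth (ZMod p) O] [CharP O p]
    (hdim : ringKrullDim O = 2) {Γ : Set O} (hΓ : IsPBasisOver p (frobenius O p).range Γ)
    {x y f : O} (hx : x ∈ Γ) (hy : y ∈ Γ) (hxy : Ideal.span {x, y} = maximalIdeal O) {a b : ℕ}
    (hJ : Ideal.span {v : O | ∃ D : Derivation ℤ O O, x ∣ D x ∧ y ∣ D y ∧ D f = v} =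
      Ideal.span {x ^ a * y ^ b})
    (hcx : derivJacobianIdeal O f ≤ Ideal.span {x}) (hcy : derivJacobianIdeal O f ≤ Ideal.span {y}) :
    2 ≤ a := by
  classical
  haveI : IsDomain O := isDomain_of_isRegularLocalRing O
  obtain ⟨hPx, hyx⟩ := isPrime_span_singleton_and_not_mem_of_rsop₂ hdim hxy
  have hyx' : Ideal.span {y, x} = maximalIdeal O := by rw [Set.pair_comm]; exact hxy
  obtain ⟨hPy, hxy'⟩ := isPrime_span_singleton_and_not_mem_of_rsop₂ hdim hyx'
  have hxm : x ∈ maximalIdeal O := hxy ▸ Ideal.subset_span (by simp)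
  -- `xᵃyᵇ ∈ J ⊆ J(O, f)`
  have hmemJ : x ^ a * y ^ b ∈
      Ideal.span {v : O | ∃ D : Derivation ℤ O O, x ∣ D x ∧ y ∣ D y ∧ D f = v} := by
    rw [hJ]; exact Ideal.mem_span_singleton_self _
  have hmem : x ^ a * y ^ b ∈ derivJacobianIdeal O f :=
    span_logDerivation_le_derivJacobianIdeal x y f hmemJ
  -- `a ≥ 1`, `b ≥ 1`
  have ha1 : 1 ≤ a := by
    by_contra h0
    have ha0 : a = 0 := by omega
    rw [ha0, pow_zero, one_mul] at hmem
    exact hyx (hPx.mem_of_pow_mem b (hcx hmem))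
  have hb1 : 1 ≤ b := by
    by_contra h0
    have hb0 : b = 0 := by omega
    rw [hb0, pow_zero, mul_one] at hmem
    exact hxy' (hPy.mem_of_pow_mem a (hcy hmem))
  -- the maximiser realises `f = gᵖ + u·(xᵃyᵇ)`
  obtain ⟨g, hg⟩ := exists_eq_pow_add_mul_of_logDerivation_dvd hΓ hx hy f
  obtain ⟨u, hu⟩ := (hg a b).1 fun D hDx hDy => by
    have h1 : D f ∈ Ideal.span {x ^ a * y ^ b} := by
      rw [← hJ]; exact Ideal.subset_span ⟨D, hDx, hDy, rfl⟩
    exact Ideal.mem_span_singleton.mp h1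
  -- suppose `a = 1`
  by_contra h2
  have ha : a = 1 := by omega
  subst ha
  obtain ⟨δ₀, δ₁, h₀x, h₀y, -, h₁y⟩ := exists_dual_pair p hdim hxy
  have hy0 : y ≠ 0 := fun h => by simp [h] at h₁y
  -- `∂ₓ f = x·(…) + yᵇ u ∈ (x)` forces `u ∈ (x)`
  have hδf : δ₀ f = x * (u * δ₀ (y ^ b) + y ^ b * δ₀ u) + y ^ b * u := by
    rw [hu, pow_one, map_add, derivation_apply_pow_char p δ₀ g, zero_add, Derivation.leibniz,
      Derivation.leibniz, h₀x]
    simp only [smul_eq_mul]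
    ring
  have h3 : δ₀ f ∈ Ideal.span {x} := hcx (Ideal.subset_span ⟨δ₀, rfl⟩)
  have h4 : y ^ b * u ∈ Ideal.span {x} := by
    rw [hδf] at h3
    exact (Submodule.add_mem_iff_right _
      (Ideal.mul_mem_right _ _ (Ideal.mem_span_singleton_self x))).mp h3
  have h5 : u ∈ Ideal.span {x} :=
    (hPx.mem_or_mem h4).resolve_left fun h => hyx (hPx.mem_of_pow_mem b h)
  obtain ⟨u', hu'⟩ := Ideal.mem_span_singleton'.mp h5
  have hu2 : f = g ^ p + u' * (x ^ 2 * y ^ b) := by rw [hu, ← hu']; ring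
  -- hence `J ⊆ (x²yᵇ)` and `x yᵇ ∈ (x²yᵇ)`
  have h6 : x ^ 1 * y ^ b ∈ Ideal.span {x ^ 2 * y ^ b} := by
    refine (Ideal.span_le.mpr ?_) hmemJ
    rintro v ⟨D, ⟨s, hs⟩, ⟨t, ht⟩, rfl⟩
    rw [SetLike.mem_coe, Ideal.mem_span_singleton,
      derivation_apply_realiser p D (by norm_num) hb1 hu2 hs ht]
    exact Dvd.intro _ rfl
  obtain ⟨r, hr⟩ := Ideal.mem_span_singleton'.mp h6
  have h7 := mul_eq_zero_of_mul_sq_mul_eq hxm hr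
  rcases mul_eq_zero.mp h7 with h | h
  · exact absurd h fun h0 => by simp [h0] at h₀x
  · exact hy0 (pow_eq_zero_iff (by omega) |>.mp h)

/-- **Crossing point, both branches critical ⇒ `a ≥ 2` and `b ≥ 2`.** [cite: Giraud1983, Prop. 1.5,
proof p. 113] -/
theorem two_le_of_span_logDerivation_eq (p : ℕ) [Fact p.Prime] {O : Type u} [CommRing O]
    [IsRegularLocalRing O] [Algebra (ZMod p) O] [Algebra.FormallySmooth (ZMod p) O] [CharP O p]
    (hdim : ringKrullDim O = 2) {Γ : Set O} (hΓ : IsPBasisOver p (frobenius O p).range Γ)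
    {x y f : O} (hx : x ∈ Γ) (hy : y ∈ Γ) (hxy : Ideal.span {x, y} = maximalIdeal O) {a b : ℕ}
    (hJ : Ideal.span {v : O | ∃ D : Derivation ℤ O O, x ∣ D x ∧ y ∣ D y ∧ D f = v} =
      Ideal.span {x ^ a * y ^ b})
    (hcx : derivJacobianIdeal O f ≤ Ideal.span {x}) (hcy : derivJacobianIdeal O f ≤ Ideal.span {y}) :
    2 ≤ a ∧ 2 ≤ b := by
  refine ⟨two_le_fst_of_span_logDerivation_eq p hdim hΓ hx hy hxy hJ hcx hcy, ?_⟩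
  have hyx : Ideal.span {y, x} = maximalIdeal O := by rw [Set.pair_comm]; exact hxy
  have hJ' : Ideal.span {v : O | ∃ D : Derivation ℤ O O, y ∣ D y ∧ x ∣ D x ∧ D f = v} =
      Ideal.span {y ^ b * x ^ a} := by
    have hs : {v : O | ∃ D : Derivation ℤ O O, y ∣ D y ∧ x ∣ D x ∧ D f = v} =
        {v : O | ∃ D : Derivation ℤ O O, x ∣ D x ∧ y ∣ D y ∧ D f = v} := by
      ext v; simp only [Set.mem_setOf_eq, and_left_comm]
    rw [hs, hJ, mul_comm]
  exact two_le_fst_of_span_logDerivation_eq p hdim hΓ hy hx hyx hJ' hcy hcx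

/-- **Non-crossing point, the branch critical ⇒ `a ≥ 2`.** [cite: Giraud1983, Prop. 1.5, proof
p. 113] -/
theorem two_le_of_span_logDerivation_eq₁ (p : ℕ) [Fact p.Prime] {O : Type u} [CommRing O]
    [IsRegularLocalRing O] [Algebra (ZMod p) O] [Algebra.FormallySmooth (ZMod p) O] [CharP O p]
    (hdim : ringKrullDim O = 2) {Γ : Set O} (hΓ : IsPBasisOver p (frobenius O p).range Γ)
    {x y f : O} (hx : x ∈ Γ) (hxy : Ideal.span {x, y} = maximalIdeal O) {a : ℕ}
    (hJ : Ideal.span {v : O | ∃ D : Derivation ℤ O O, x ∣ D x ∧ D f = v} = Ideal.span {x ^ a})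
    (hcx : derivJacobianIdeal O f ≤ Ideal.span {x}) : 2 ≤ a := by
  classical
  haveI : IsDomain O := isDomain_of_isRegularLocalRing O
  have hxm : x ∈ maximalIdeal O := hxy ▸ Ideal.subset_span (by simp)
  have hmemJ : x ^ a ∈ Ideal.span {v : O | ∃ D : Derivation ℤ O O, x ∣ D x ∧ D f = v} := by
    rw [hJ]; exact Ideal.mem_span_singleton_self _
  have hmem : x ^ a ∈ derivJacobianIdeal O f := span_logDerivation_le_derivJacobianIdeal₁ x f hmemJ
  -- `a ≥ 1`
  have ha1 : 1 ≤ a := by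
    by_contra h0
    have ha0 : a = 0 := by omega
    rw [ha0, pow_zero] at hmem
    have h1 : (1 : O) ∈ maximalIdeal O :=
      Ideal.span_le.mpr (Set.singleton_subset_iff.mpr hxm) (hcx hmem)
    exact (maximalIdeal.isMaximal O).ne_top ((Ideal.eq_top_iff_one _).mpr h1)
  obtain ⟨g, hg⟩ := exists_eq_pow_add_mul_of_logDerivation_dvd₁ hΓ hx f
  obtain ⟨u, hu⟩ := (hg a).1 fun D hDx => by
    have h1 : D f ∈ Ideal.span {x ^ a} := by rw [← hJ]; exact Ideal.subset_span ⟨D, hDx, rfl⟩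
    exact Ideal.mem_span_singleton.mp h1
  by_contra h2
  have ha : a = 1 := by omega
  subst ha
  obtain ⟨δ₀, δ₁, h₀x, -, -, -⟩ := exists_dual_pair p hdim hxy
  -- `∂ₓ f = x ∂ₓu + u ∈ (x)` forces `u ∈ (x)`
  have hδf : δ₀ f = x * δ₀ u + u := by
    rw [hu, pow_one, map_add, derivation_apply_pow_char p δ₀ g, zero_add, Derivation.leibniz, h₀x]
    simp only [smul_eq_mul]
    ring
  have h3 : δ₀ f ∈ Ideal.span {x} := hcx (Ideal.subset_span ⟨δ₀, rfl⟩)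
  have h5 : u ∈ Ideal.span {x} := by
    rw [hδf] at h3
    exact (Submodule.add_mem_iff_right _
      (Ideal.mul_mem_right _ _ (Ideal.mem_span_singleton_self x))).mp h3
  obtain ⟨u', hu'⟩ := Ideal.mem_span_singleton'.mp h5
  have hu2 : f = g ^ p + u' * x ^ 2 := by rw [hu, ← hu']; ring
  have h6 : x ^ 1 ∈ Ideal.span {x ^ 2} := by
    refine (Ideal.span_le.mpr ?_) hmemJ
    rintro v ⟨D, ⟨s, hs⟩, rfl⟩
    rw [SetLike.mem_coe, Ideal.mem_span_singleton, derivation_apply_realiser₁ p D (by norm_num) hu2 hs]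
    exact Dvd.intro _ rfl
  obtain ⟨r, hr⟩ := Ideal.mem_span_singleton'.mp h6
  have h7 := mul_eq_zero_of_mul_sq_mul_eq hxm (m := 1) (by simpa using hr)
  rw [mul_one] at h7
  simp [h7] at h₀x

/-! ## § 2 The read-off at a critical point from criticality (no `2 ≤ a` hypotheses) -/

/-- **B7 PARTS (3)+(4)+(5), crossing point**: both branches of `E(f)` through the point critical
(`J(O,f) ⊆ (x)`, `J(O,f) ⊆ (y)`) and `J(O, f; log x, y) = (xᵃyᵇ)` ⇒ `Giraud15NormalFormAt p f`.
[cite: Giraud1983, Prop. 1.5 (i) ⇒ (ii), p. 113] -/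
theorem giraud15NormalFormAt_crossing_of_critical (p : ℕ) [Fact p.Prime] {O : Type u}
    [CommRing O] [IsRegularLocalRing O] [Algebra (ZMod p) O] [Algebra.FormallySmooth (ZMod p) O]
    [CharP O p] (hdim : ringKrullDim O = 2) {Γ : Set O}
    (hΓ : IsPBasisOver p (frobenius O p).range Γ) {x y f : O} (hx : x ∈ Γ) (hy : y ∈ Γ)
    (hxy : Ideal.span {x, y} = maximalIdeal O) {a b : ℕ}
    (hJ : Ideal.span {v : O | ∃ D : Derivation ℤ O O, x ∣ D x ∧ y ∣ D y ∧ D f = v} =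
      Ideal.span {x ^ a * y ^ b})
    (hcx : derivJacobianIdeal O f ≤ Ideal.span {x}) (hcy : derivJacobianIdeal O f ≤ Ideal.span {y}) :
    Giraud15NormalFormAt p f := by
  obtain ⟨ha, hb⟩ := two_le_of_span_logDerivation_eq p hdim hΓ hx hy hxy hJ hcx hcy
  exact giraud15NormalFormAt_crossing_of_span_logDerivation_eq p hdim hΓ hx hy hxy ha hb hJ

/-- **B7 PARTS (3)+(4)+(5), non-crossing point**: the branch `x = 0` critical (`J(O,f) ⊆ (x)`) and
`J(O, f; log x) = (xᵃ)` ⇒ `Giraud15NormalFormAt p f`. [cite: Giraud1983, Prop. 1.5 (i) ⇒ (ii),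
p. 113] -/
theorem giraud15NormalFormAt_noncrossing_of_critical (p : ℕ) [Fact p.Prime] {O : Type u}
    [CommRing O] [IsRegularLocalRing O] [Algebra (ZMod p) O] [Algebra.FormallySmooth (ZMod p) O]
    [CharP O p] (hdim : ringKrullDim O = 2) {Γ : Set O}
    (hΓ : IsPBasisOver p (frobenius O p).range Γ) {x y f : O} (hx : x ∈ Γ)
    (hxy : Ideal.span {x, y} = maximalIdeal O) {a : ℕ}
    (hJ : Ideal.span {v : O | ∃ D : Derivation ℤ O O, x ∣ D x ∧ D f = v} = Ideal.span {x ^ a})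
    (hcx : derivJacobianIdeal O f ≤ Ideal.span {x}) : Giraud15NormalFormAt p f :=
  giraud15NormalFormAt_noncrossing_of_span_logDerivation_eq p hdim hΓ hx hxy
    (two_le_of_span_logDerivation_eq₁ p hdim hΓ hx hxy hJ hcx) hJ

end Summit.ResolutionOfSingularities.ResolutionOfSingularities.Theorems.RadicialJung.CleanModels

end
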